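import Literature.Topology.FourManifolds.HomotopySpheresGroupAssembly
import Literature.Topology.FourManifolds.HomotopySpheresInverseProofs
import Literature.Topology.FourManifolds.HomotopySpheresInverseBoundsContractible
import HarnessLib

/-!
# Inverses in `Θₙ`: the target fact from its two remaining leaves

Third sibling proofs file of `HomotopySpheresInverse.lean` (the decomposition of the named fact
`Literature.Topology.FourManifolds.HomotopySphere.isHCobordant_sphere_of_isOrientedConnectedSum_neg`:
`Σ # (-Σ)` is h-cobordant to `𝕊ⁿ`, Kervaire–Milnor, *Groups of homotopy spheres I*, Ann. of Math. 77
(1963), Lemmas 2.3–2.4, pp. 506–507), after `HomotopySpheresInverseProofs.lean` (the smooth half of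
Lemma 2.3, `NullCobordism.exists_cobordism_sphere_compl_ball_holds`) and
`HomotopySpheresInverseBoundsContractible.lean` (the smooth half of Lemma 2.4,
`HomotopySphere.exists_nullCobordism_isOrientedConnectedSum_neg_holds`, Kervaire–Milnor's rotation
construction via `RotationBodyRetract.lean`). Both smooth constructions with boundary being theorems,
and the Palais–Cerf uniqueness of oriented connected sums being a theorem
(`HomotopySphere.boundsContractible_of_isOrientedConnectedSum_neg_of_exists'`,
`HomotopySpheresGroupAssembly.lean`), the decomposition has exactly two leaves left:

* `HomotopySphere.boundsContractible_of_isOrientedConnectedSum_neg_of_compl_singleton`: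
  Kervaire–Milnor's Lemma 2.4 for EVERY sum `Σ # (-Σ)` GIVEN only the contractibility of punctured
  homotopy spheres (`HomotopySphere.contractibleSpace_compl_singleton`) — the Palais–Cerf hypothesis
  of `…_of_contractibleSpace_compl_singleton` discharged;
* `HomotopySphere.isHCobordant_sphere_of_isOrientedConnectedSum_neg_of_twoLeaves`: **the target fact
  from the two remaining leaves** — the homotopy theory of Lemma 2.3
  (`NullCobordism.isHomotopyEquiv_compl_ball_of_contractibleSpace`: excision, Poincaré duality,
  Whitehead) and the contractibility of a homotopy sphere with an open disc deleted
  (`HomotopySphere.contractibleSpace_compl_image_ball`: Whitehead–Hurewicz) — compare `…_of_leaves`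
  of `HomotopySpheresGroupLeaves.lean`, which still takes the rotation construction as a third
  hypothesis; and `…_of_facts`: the same with the latter taken from the Whitehead–Hurewicz
  recognition principle and the smooth Poincaré conjecture in dimensions `1, 2` (spc4.S32);
* `exists_commGroup_homotopySphereClass_of_fourLeaves`: Kervaire–Milnor's Theorem 1.1 for
  `Θₙ = HomotopySphereClass n`, `n ≠ 0, 4`, from FOUR named facts — spc4.S32 (smooth Poincaré
  conjecture in dimensions `≤ 3`), `HomotopySphere.contractibleSpace_compl_image_ball`,
  `NullCobordism.isHomotopyEquiv_compl_ball_of_contractibleSpace`, and spc4.S15 (Smale's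
  h-cobordism theorem); every differential-topological step of §2 of the paper is now proved.

A different route to the target, which avoids the two leaves above in favour of Whitehead's theorem
and the CW type of manifolds, is `RotationBodyHCobordism.lean`.

## References

* M. Kervaire, J. Milnor, *Groups of homotopy spheres I*, Ann. of Math. (2) 77 (1963), 504–537:
  Lemma 2.3 (p. 506), Lemma 2.4 (p. 507), proof of Thm 1.1 (p. 507). doi:10.2307/1970128
  [KervaireMilnorAnnals1963]
-/

open scoped Manifold ContDiff Topology ContinuousMap
open Set

noncomputable section

namespace Literature.Topology.FourManifolds

/-- **Kervaire–Milnor's Lemma 2.4 for every sum `Σ # (-Σ)`, GIVEN only the contractibility of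
punctured homotopy spheres**: the rotation body and the Palais–Cerf uniqueness of oriented connected
sums are theorems (`HomotopySphere.exists_isOrientedConnectedSum_neg_boundsContractible_of_contractibleSpace_compl_singleton`,
`HomotopySphere.boundsContractible_of_isOrientedConnectedSum_neg_of_exists'`).
[cite: KervaireMilnorAnnals1963, Lemmas 2.1 and 2.4 (pp. 505, 507)] -/
theorem HomotopySphere.boundsContractible_of_isOrientedConnectedSum_neg_of_compl_singleton
    (h24b : HomotopySphere.contractibleSpace_compl_singleton) :
    HomotopySphere.boundsContractible_of_isOrientedConnectedSum_neg :=
  HomotopySphere.boundsContractible_of_isOrientedConnectedSum_neg_of_exists'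
    (HomotopySphere.exists_isOrientedConnectedSum_neg_boundsContractible_of_contractibleSpace_compl_singleton
      h24b)

/-- **`Σ # (-Σ)` is h-cobordant to `𝕊ⁿ` (`n ≥ 2`) from the two remaining leaves.** The named fact
`HomotopySphere.isHCobordant_sphere_of_isOrientedConnectedSum_neg` of `HomotopySpheresGroup.lean`
(Kervaire–Milnor 1963, Lemmas 2.3–2.4 and proof of Thm 1.1, pp. 506–507) follows from
(a) the homotopy theory in the proof of Lemma 2.3
(`NullCobordism.isHomotopyEquiv_compl_ball_of_contractibleSpace`) and (b) the contractibility of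
a homotopy sphere with an open disc deleted (`HomotopySphere.contractibleSpace_compl_image_ball`,
which gives both the contractibility of `Σ ∖ {p}` in Lemma 2.4 and, through the p. 505 remark, the
simple connectivity of the `2`-dimensional sums `Σ # (-Σ)`); all the differential topology of the
two lemmas is proved. [cite: KervaireMilnorAnnals1963, Lemmas 2.3–2.4 and proof of Thm. 1.1 (pp. 506–507)] -/
theorem HomotopySphere.isHCobordant_sphere_of_isOrientedConnectedSum_neg_of_twoLeaves
    (h23b : NullCobordism.isHomotopyEquiv_compl_ball_of_contractibleSpace)
    (hKball : HomotopySphere.contractibleSpace_compl_image_ball) :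
    HomotopySphere.isHCobordant_sphere_of_isOrientedConnectedSum_neg :=
  HomotopySphere.isHCobordant_sphere_of_isOrientedConnectedSum_neg_of
    (isHCobordant_sphere_of_boundsContractible_of_isHomotopyEquiv h23b)
    (HomotopySphere.boundsContractible_of_isOrientedConnectedSum_neg_of_compl_singleton
      (HomotopySphere.contractibleSpace_compl_singleton_of_compl_image_ball hKball))
    (HomotopySphere.nonempty_homotopyEquiv_sphere_of_isConnectedSum_of hKball)

/-- **The target fact from the homotopy theory of Lemma 2.3, the Whitehead–Hurewicz recognition
principle and the smooth Poincaré conjecture in dimensions `1, 2`**: as `…_of_twoLeaves`, the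
contractibility of punctured homotopy spheres being taken from
`Literature.AlgebraicTopology.Homotopy.Manifold.contractibleSpace_of_simplyConnected_of_acyclic`
(Bredon 1993, VII Cor. 10.11 + Milnor 1959, Cor. 1) and `nonemptyDiffeomorphSphere_of_mem`
(spc4.S32) by `HomotopySphere.contractibleSpace_compl_image_ball_of_facts`.
[cite: KervaireMilnorAnnals1963, Lemmas 2.3–2.4 and proof of Thm. 1.1 (pp. 506–507)] -/
theorem HomotopySphere.isHCobordant_sphere_of_isOrientedConnectedSum_neg_of_facts
    (h23b : NullCobordism.isHomotopyEquiv_compl_ball_of_contractibleSpace)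
    (hW : Literature.AlgebraicTopology.Homotopy.Manifold.contractibleSpace_of_simplyConnected_of_acyclic.{0})
    (h32 : FourManifolds.nonemptyDiffeomorphSphere_of_mem.{0}) :
    HomotopySphere.isHCobordant_sphere_of_isOrientedConnectedSum_neg :=
  HomotopySphere.isHCobordant_sphere_of_isOrientedConnectedSum_neg_of_twoLeaves h23b
    (HomotopySphere.contractibleSpace_compl_image_ball_of_facts hW h32)

/-- **Kervaire–Milnor's Theorem 1.1 for `Θₙ = HomotopySphereClass n`, `n ≠ 0, 4`, from FOUR named
facts**: (i) the smooth Poincaré conjecture in dimensions `≤ 3`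
(`SPC4.nonemptyDiffeomorphSphere_of_mem`, spc4.S32; Kervaire–Milnor p. 507 + Perelman), (ii) a
homotopy sphere with an open disc deleted is contractible
(`HomotopySphere.contractibleSpace_compl_image_ball`; Whitehead–Hurewicz), (iii) the homotopy
theory of Lemma 2.3 (`NullCobordism.isHomotopyEquiv_compl_ball_of_contractibleSpace`; excision,
Poincaré duality, Whitehead), (iv) Smale's h-cobordism theorem
(`SPC4.nonempty_diffeomorph_of_isHCobordant_of_five_le`, spc4.S15). Compared with
`exists_commGroup_homotopySphereClass_of_leaves` (six facts), the two smooth constructions with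
boundary of Lemmas 2.3–2.4 — ball removal and the rotation body — are now theorems.
[cite: KervaireMilnorAnnals1963, Thm. 1.1, §2 pp. 504–507] -/
theorem exists_commGroup_homotopySphereClass_of_fourLeaves
    (hlow : FourManifolds.nonemptyDiffeomorphSphere_of_mem.{0})
    (hKball : HomotopySphere.contractibleSpace_compl_image_ball)
    (h23b : NullCobordism.isHomotopyEquiv_compl_ball_of_contractibleSpace)
    (hS15 : FourManifolds.nonempty_diffeomorph_of_isHCobordant_of_five_le.{0}) :
    exists_commGroup_homotopySphereClass :=
  exists_commGroup_homotopySphereClass_of_leaves hlow hKball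
    NullCobordism.exists_cobordism_sphere_compl_ball_holds h23b
    HomotopySphere.exists_nullCobordism_isOrientedConnectedSum_neg_holds hS15

end Literature.Topology.FourManifolds
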